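import Summits.ValiantsHypothesis.ValiantsHypothesis.Theorems.NcParseTreeValues
import HarnessLib

/-!
# Designation, the zero-constant parse-tree model and designated sums (FLOS20 Thm 5/13) — H2a

FLOS20 = Fijalkow–Lagarde–Ohlmann–Serre, STACS 2020. H2 of O-L6-20 = THIS FILE + the rank file
`NcHankelIntervalBound` (span theorem `dsum_mem_uptSpan`, `hankel_interval_bound`), over the landed
binary parse trees `circuitPts` / `ptVal` of `NcParseTrees` (LLS18 §2), with NO pointed trees.
THIS FILE (INSTRUMENT, «zero-constant» model = const operands allowed iff they are `0`): the
DESIGNATED node of a shape placed at an offset = its first internal node in preorder whose absolute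
interval `(offset, size)` is `good` (`des`, `des_spec`); soundness `ptVal_circuitPts₀` (steps
`ptVal_opPts₀`, `ptVal_sumPts₀`, `ptVal_gatePts₀`, `ptVal_ptLists₀`; S4 `ptVal_circuitPts` has NO
constants, same proof); terms are scalar multiples of words (`opPts_word`), so degree components of
term sums are sub-sums (`degPart_ptVal_filter`, `degPart_term`, `degPart_ncEval_eq_ptVal_filter`);
the DESIGNATED SUM `D(L; α, ℓ, I)` (`dsum`) and its bilinear expansion at a product gate whose
root is not good (`dsum_pairPts`). Scalars: any commutative semiring; any alphabet.
MODEL (verbatim for every file): «Circuits ArithCircuit K σ read in FreeAlgebra K σ (ncEval), K a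
field, σ finite; weighted sum gates of any fan-in, product gates of fan-in 1 or 2 (general fan-in:
the landed binz of O-L6-19); the INPUT circuit of a rung is const-free with non-constant output
(print: homogenisation, HWY10 §2 / LMS16 Lemma 4.2 — not formalised; same clause as
ncPerPoly_uptPrint); the instrument (H2) is proved in the wider ZERO-CONST model (const operands
allowed iff 0) so that block substitutions with vanishing entries stay inside it.»
print-KNOWN (FLOS20 Theorem 13; the rank-one heart of Theorem 5 without pointed trees) ·
kernel-NEW (no general-circuit parse-tree rank instrument in the tree) · INSTRUMENT ·
0 S-currency · closes NO item · A_nc stmt-23446 / PerNotNcVP / VP ≠ VNP untouched.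
[cite: FijalkowLagardeOhlmannSerre2020, Theorem 5 (p. 7–8), Theorem 13 (p. 12)]
[cite: LagardeLimayeSrinivasan2018, §2 (parse trees)]
[cite: LimayeMalodSrinivasan2016, Lemma 4.2 (homogenisation, print only)]
[cite: HrubesWigdersonYehudayoff2010, §2 (homogeneous components)]
-/

noncomputable section

namespace Summit.ValiantsHypothesis.ValiantsHypothesis.Theorems.NcHankelIntervalModel

set_option linter.dupNamespace false
open Literature.Computability.AlgebraicComplexity
  Literature.Computability.AlgebraicComplexity.ArithCircuit
  Summit.ValiantsHypothesis.ValiantsHypothesis.Theorems.NcAutomatonIntersection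
  Summit.ValiantsHypothesis.ValiantsHypothesis.Theorems.NcCentralWidth
  Summit.ValiantsHypothesis.ValiantsHypothesis.Theorems.NcSOSDegreeFour
  Summit.ValiantsHypothesis.ValiantsHypothesis.Theorems.NcUniqueParseTree
  Summit.ValiantsHypothesis.ValiantsHypothesis.Theorems.NcParseTrees
  Summit.ValiantsHypothesis.ValiantsHypothesis.Theorems.NcParseTreeValues

universe u v

/-! ### §1 Designation on shapes -/

/-- **Designation**: the absolute interval `(offset, size)` of the FIRST internal node in preorder of
the shape `S` placed at offset `α` whose interval is `good`, if any.
[cite: FijalkowLagardeOhlmannSerre2020, Theorem 5] -/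
def des (good : ℕ → ℕ → Bool) : Shape → ℕ → Option (ℕ × ℕ)
  | .leaf, _ => none
  | .node l r, α =>
    if good α (l.size + r.size) then some (α, l.size + r.size)
    else (des good l α).or (des good r (α + l.size))

/-- A designated interval is good, internal (`2 ≤` size) and inside the shape.
[cite: FijalkowLagardeOhlmannSerre2020, Theorem 5] -/
theorem des_spec {good : ℕ → ℕ → Bool} {S : Shape} {α a m : ℕ}
    (h : des good S α = some (a, m)) : good a m = true ∧ 2 ≤ m ∧ α ≤ a ∧ a + m ≤ α + S.size := by
  induction S generalizing α with
  | leaf => simp [des] at h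
  | node l r ihl ihr =>
    have hl := (length_nodes l).2
    have hr := (length_nodes r).2
    simp only [des] at h
    split_ifs at h with hg
    · rw [Option.some.injEq, Prod.mk.injEq] at h
      obtain ⟨h1, h2⟩ := h
      refine ⟨by rw [← h1, ← h2]; exact hg, by omega, by omega, ?_⟩
      show a + m ≤ α + (l.size + r.size); omega
    · cases hdl : des good l α with
      | some J =>
        rw [hdl, Option.some_or, Option.some.injEq] at h
        rw [h] at hdl
        obtain ⟨h1, h2, h3, h4⟩ := ihl hdl
        refine ⟨h1, h2, h3, ?_⟩
        show a + m ≤ α + (l.size + r.size); omega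
      | none =>
        rw [hdl, Option.none_or] at h
        obtain ⟨h1, h2, h3, h4⟩ := ihr h
        refine ⟨h1, h2, by omega, ?_⟩
        show a + m ≤ α + (l.size + r.size); omega

/-! ### §2 Parse trees in the ZERO-CONSTANT model (const operands allowed iff they are `0`) -/

section Model

variable {R : Type u} [CommSemiring R] {σ : Type v}

/-- Zero-constant soundness, operands (`const 0`: no tree). [cite: LagardeLimayeSrinivasan2018, §2] -/
theorem ptVal_opPts₀ {W : List (List (Shape × FreeAlgebra R σ))} {vals : List (FreeAlgebra R σ)}
    (hW : ∀ j, ptVal (W.getD j []) = vals.getD j 0) (u : Operand R σ)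
    (hu : ∀ c, u = Operand.const c → c = 0) : ptVal (opPts W u) = u.ncEval vals := by
  cases u with
  | var x => simp [opPts, ptVal, Operand.ncEval]
  | const c => simp [opPts, ptVal, Operand.ncEval, hu c rfl]
  | gate j => simpa [opPts, Operand.ncEval] using hW j

/-- Zero-constant soundness, weighted sums of operands. [cite: LagardeLimayeSrinivasan2018, §2] -/
theorem ptVal_sumPts₀ {W : List (List (Shape × FreeAlgebra R σ))} {vals : List (FreeAlgebra R σ)}
    (hW : ∀ j, ptVal (W.getD j []) = vals.getD j 0) (args : List (R × Operand R σ))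
    (hc : ∀ a ∈ args, ∀ c, a.2 = Operand.const c → c = 0) :
    ptVal (sumPts W args) = (args.map fun a => a.1 • a.2.ncEval vals).sum := by
  induction args with
  | nil => simp [sumPts, ptVal]
  | cons a rest ih =>
    rw [sumPts, ptVal_append, ptVal_map_smul, ptVal_opPts₀ hW a.2 (hc a (by simp)),
      ih fun b hb => hc b (by simp [hb]), List.map_cons, List.sum_cons]

/-- Zero-constant soundness, gates (products of fan-in 1, 2). [cite: LagardeLimayeSrinivasan2018, §2] -/
theorem ptVal_gatePts₀ {W : List (List (Shape × FreeAlgebra R σ))} {vals : List (FreeAlgebra R σ)}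
    (hW : ∀ j, ptVal (W.getD j []) = vals.getD j 0) (g : Gate R σ)
    (hc : ∀ u ∈ g.args, ∀ c, u = Operand.const c → c = 0)
    (hp : ∀ args, g = Gate.prod args → args.length = 1 ∨ args.length = 2) :
    ptVal (gatePts W g) = g.ncEval vals := by
  rcases g with args | (_ | ⟨u, _ | ⟨u', _ | _⟩⟩)
  · exact ptVal_sumPts₀ hW args fun a ha => hc a.2 (by
      simp only [Gate.args]; exact List.mem_map.2 ⟨a, ha, rfl⟩)
  · rcases hp [] rfl with h | h <;> simp only [List.length_nil] at h <;> omega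
  · simp only [gatePts, Gate.ncEval, List.map_cons, List.map_nil, List.prod_cons, List.prod_nil,
      mul_one]
    exact ptVal_opPts₀ hW u (hc u (by simp [Gate.args]))
  · simp only [gatePts, Gate.ncEval, List.map_cons, List.map_nil, List.prod_cons, List.prod_nil,
      mul_one]
    rw [ptVal_pairPts, ptVal_opPts₀ hW u (hc u (by simp [Gate.args])),
      ptVal_opPts₀ hW u' (hc u' (by simp [Gate.args]))]
  · rcases hp _ rfl with h | h <;> simp only [List.length_cons] at h <;> omega

/-- Zero-constant soundness, gate lists (slot by slot). [cite: LagardeLimayeSrinivasan2018, §2] -/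
theorem ptVal_ptLists₀ (gs : List (Gate R σ))
    (hc : ∀ g ∈ gs, ∀ u ∈ g.args, ∀ c, u = Operand.const c → c = 0)
    (hp : ∀ args, Gate.prod args ∈ gs → args.length = 1 ∨ args.length = 2) (j : ℕ) :
    ptVal ((ptLists gs).getD j []) = (ncGateValues gs).getD j 0 := by
  induction gs using List.reverseRecOn generalizing j with
  | nil => simp [ptLists, ncGateValues, ptVal]
  | append_singleton gs g ih =>
    have ih' : ∀ j, ptVal ((ptLists gs).getD j []) = (ncGateValues gs).getD j 0 := fun j =>
      ih (fun g' hg' => hc g' (List.mem_append_left _ hg'))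
        (fun args h => hp args (List.mem_append_left _ h)) j
    rcases Nat.lt_trichotomy j gs.length with hj | rfl | hj
    · rw [ptLists_getD_append gs [g] hj, (ncGateValues_append_getD gs [g]).2 j hj, ih' j]
    · rw [ncGateValues_getD_length, ptLists_append_singleton,
        List.getD_append_right _ _ _ _ (length_ptLists gs).le, length_ptLists, Nat.sub_self,
        List.getD_cons_zero]
      exact ptVal_gatePts₀ ih' g (hc g (by simp)) fun args h => hp args (by rw [← h]; simp)
    · have h1 : (ptLists (gs ++ [g])).length ≤ j := by
        rw [length_ptLists, List.length_append, List.length_singleton]; omega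
      have h2 : (ncGateValues (gs ++ [g])).length ≤ j := by
        rw [(ncGateValues_append_getD gs [g]).1, List.length_singleton]; omega
      rw [List.getD_eq_default _ _ h1, List.getD_eq_default _ _ h2]; simp [ptVal]

/-- **Soundness in the zero-constant model**: with const operands all `0`, products of fan-in 1 or 2
and the output not a non-zero constant, `P.ncEval` is the sum of the terms of its parse trees
(S4 `ptVal_circuitPts` has NO constants; same proof). [cite: LagardeLimayeSrinivasan2018, §2] -/
theorem ptVal_circuitPts₀ (P : ArithCircuit R σ)
    (hc : ∀ g ∈ P.gates, ∀ u ∈ g.args, ∀ c, u = Operand.const c → c = 0)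
    (hp : ∀ args, Gate.prod args ∈ P.gates → args.length = 1 ∨ args.length = 2)
    (ho : ∀ c, P.output = Operand.const c → c = 0) : ptVal (circuitPts P) = P.ncEval :=
  ptVal_opPts₀ (ptVal_ptLists₀ P.gates hc hp) P.output ho

/-- Every parse-tree term is a scalar multiple of a WORD with as many letters as its shape has
leaves (all circuits, no hypotheses; prefix induction). [cite: LagardeLimayeSrinivasan2018, §2] -/
theorem opPts_word (gs : List (Gate R σ)) (u : Operand R σ) :
    ∀ e ∈ opPts (ptLists gs) u, ∃ c : R, ∃ w : List σ,
      w.length = e.1.size ∧ e.2 = c • (w.map (FreeAlgebra.ι R)).prod := by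
  -- operands from slots: a letter is the one-letter word, a constant has no parse tree
  have hlift : ∀ W : List (List (Shape × FreeAlgebra R σ)), (∀ j, ∀ e ∈ W.getD j [], ∃ c : R,
      ∃ w : List σ, w.length = e.1.size ∧ e.2 = c • (w.map (FreeAlgebra.ι R)).prod) →
      ∀ (v : Operand R σ), ∀ e ∈ opPts W v, ∃ c : R, ∃ w : List σ,
        w.length = e.1.size ∧ e.2 = c • (w.map (FreeAlgebra.ι R)).prod := by
    intro W hW v e he
    cases v with
    | var x =>
      rw [opPts, List.mem_singleton] at he
      rw [he]
      exact ⟨1, [x], rfl, by simp⟩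
    | const c => rw [opPts] at he; exact absurd he List.not_mem_nil
    | gate j => exact hW j e he
  refine hlift (ptLists gs) ?_ u
  induction gs using List.reverseRecOn with
  | nil => intro j e he; simp [ptLists] at he
  | append_singleton gs g ih =>
    have hop := hlift (ptLists gs) ih
    intro j e he
    rcases Nat.lt_trichotomy j gs.length with hj | rfl | hj
    · rw [ptLists_getD_append gs [g] hj] at he
      exact ih j e he
    · rw [ptLists_append_singleton, List.getD_append_right _ _ _ _ (length_ptLists gs).le,
        length_ptLists, Nat.sub_self, List.getD_cons_zero] at he
      rcases g with args | (_ | ⟨u, _ | ⟨u', _ | ⟨u'', rest⟩⟩⟩)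
      · simp only [gatePts] at he
        induction args with
        | nil => simp [sumPts] at he
        | cons a rest iha =>
          rw [sumPts, List.mem_append, List.mem_map] at he
          rcases he with ⟨f, hf, rfl⟩ | he
          · obtain ⟨c, w, hw, hfw⟩ := hop a.2 f hf
            exact ⟨a.1 * c, w, hw, show a.1 • f.2 = _ by rw [hfw, smul_smul]⟩
          · exact iha he
      · rw [show gatePts (ptLists gs) (Gate.prod []) = [] from rfl] at he
        exact absurd he List.not_mem_nil
      · simp only [gatePts] at he
        exact hop u e he
      · simp only [gatePts] at he
        have hL := hop u
        revert he hL
        generalize opPts (ptLists gs) u = L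
        intro he hL
        induction L with
        | nil => simp [pairPts] at he
        | cons x L ihL =>
          rw [pairPts, List.mem_append, List.mem_map] at he
          rcases he with ⟨f, hf, rfl⟩ | he
          · obtain ⟨c₁, w₁, hw₁, hx⟩ := hL x (by simp)
            obtain ⟨c₂, w₂, hw₂, hf'⟩ := hop u' f hf
            exact ⟨c₁ * c₂, w₁ ++ w₂, show (w₁ ++ w₂).length = x.1.size + f.1.size by
              rw [List.length_append, hw₁, hw₂], show x.2 * f.2 = _ by rw [hx, hf', smul_mul_assoc,
                mul_smul_comm, smul_smul, List.map_append, List.prod_append]⟩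
          · exact ihL he fun y hy => hL y (List.mem_cons_of_mem _ hy)
      · rw [show gatePts (ptLists gs) (Gate.prod (u :: u' :: u'' :: rest)) = [] from rfl] at he
        exact absurd he List.not_mem_nil
    · have h1 : (ptLists (gs ++ [g])).length ≤ j := by
        rw [length_ptLists, List.length_append, List.length_singleton]; omega
      rw [List.getD_eq_default _ _ h1] at he
      simp at he

/-- The degree-`ℓ` component (cap `d ≥ ℓ`) of a sum of word terms is the sum of the terms with `ℓ`
leaves. [cite: LagardeLimayeSrinivasan2018, §2] -/
theorem degPart_ptVal_filter (L : List (Shape × FreeAlgebra R σ))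
    (hL : ∀ e ∈ L, ∃ c : R, ∃ w : List σ, w.length = e.1.size ∧ e.2 = c • (w.map (FreeAlgebra.ι R)).prod)
    {d ℓ : ℕ} (hℓ : ℓ ≤ d) : degPart d ℓ (ptVal L) = ptVal (L.filter fun e => e.1.size = ℓ) := by
  induction L with
  | nil => simp [ptVal]
  | cons e L ih =>
    obtain ⟨c, w, hw, he⟩ := hL e (by simp)
    have ih' := ih fun x hx => hL x (List.mem_cons_of_mem _ hx)
    have hcons : ∀ X : List (Shape × FreeAlgebra R σ), ptVal (e :: X) = e.2 + ptVal X :=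
      fun X => by simp [ptVal]
    rw [hcons, map_add, ih', List.filter_cons]
    by_cases h : e.1.size = ℓ
    · rw [if_pos (decide_eq_true h), hcons, he, map_smul, degPart_word hℓ, if_pos (hw.trans h)]
    · rw [if_neg (mt of_decide_eq_true h), he, map_smul, degPart_word hℓ,
        if_neg fun h' => h (hw.symm.trans h'), smul_zero, zero_add]

/-- Terms are homogeneous of the degree of their shape: `(S, s) ∈ T(P) ⇒ degPart d |S| s = s`
(`|S| ≤ d`). [cite: LagardeLimayeSrinivasan2018, §2] -/
theorem degPart_term (P : ArithCircuit R σ) {d : ℕ} {e : Shape × FreeAlgebra R σ}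
    (he : e ∈ circuitPts P) (hd : e.1.size ≤ d) : degPart d e.1.size e.2 = e.2 := by
  obtain ⟨c, w, hw, hcw⟩ := opPts_word P.gates P.output e he
  rw [hcw, map_smul, degPart_word hd, if_pos hw]

/-- The degree-`d` component of the output is the value of the parse trees with `d` leaves.
[cite: LagardeLimayeSrinivasan2018, §2] -/
theorem degPart_ncEval_eq_ptVal_filter (P : ArithCircuit R σ)
    (hc : ∀ g ∈ P.gates, ∀ u ∈ g.args, ∀ c, u = Operand.const c → c = 0)
    (hp : ∀ args, Gate.prod args ∈ P.gates → args.length = 1 ∨ args.length = 2)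
    (ho : ∀ c, P.output = Operand.const c → c = 0) (d : ℕ) :
    degPart d d P.ncEval = ptVal ((circuitPts P).filter fun e => e.1.size = d) := by
  rw [← ptVal_circuitPts₀ P hc hp ho]
  exact degPart_ptVal_filter (circuitPts P) (opPts_word P.gates P.output) le_rfl

/-! ### §3 Designated sums and their bilinear expansion at a product gate -/

/-- The DESIGNATED SUM `D(L; α, ℓ, I)`: the sum of the terms of the entries of `L` with `ℓ` leaves
whose designated interval (at offset `α`) is `I`. [cite: FijalkowLagardeOhlmannSerre2020, Theorem 5] -/
def dsum (good : ℕ → ℕ → Bool) (L : List (Shape × FreeAlgebra R σ)) (α ℓ : ℕ) (I : ℕ × ℕ) :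
    FreeAlgebra R σ :=
  ptVal (L.filter fun e => e.1.size = ℓ ∧ des good e.1 α = some I)

/-- **Bilinear expansion below a root that is not good**: over all pairs, the trees with `k` leaves
designated at `I` are (left designated at `I` with `n` leaves) · (right with `k − n` leaves) plus
(left undesignated with `n` leaves) · (right designated at `I`, offset `β + n`), summed over `n`.
[cite: FijalkowLagardeOhlmannSerre2020, Theorem 5] -/
theorem dsum_pairPts (good : ℕ → ℕ → Bool) (L M : List (Shape × FreeAlgebra R σ)) {β k : ℕ}
    (hg : good β k = false) (I : ℕ × ℕ) :
    dsum good (pairPts L M) β k I = ∑ n ∈ Finset.range (k + 1),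
      (dsum good L β n I * ptVal (M.filter fun f => f.1.size = k - n) +
        ptVal (L.filter fun e => e.1.size = n ∧ des good e.1 β = none) *
          dsum good M (β + n) (k - n) I) := by
  have hgk : ¬good β k = true := by rw [hg]; exact Bool.false_ne_true
  have hcons : ∀ (p : Shape × FreeAlgebra R σ → Prop) [DecidablePred p]
      (x : Shape × FreeAlgebra R σ) (X : List (Shape × FreeAlgebra R σ)),
      ptVal ((x :: X).filter fun e => p e) =
        (if p x then x.2 else 0) + ptVal (X.filter fun e => p e) := by
    intro p _ x X
    rw [List.filter_cons]
    by_cases h : p x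
    · rw [if_pos (decide_eq_true h), if_pos h]; simp [ptVal]
    · rw [if_neg (mt of_decide_eq_true h), if_neg h, zero_add]
  have happ : ∀ (X Y : List (Shape × FreeAlgebra R σ)) (n : ℕ),
      dsum good (X ++ Y) β n I = dsum good X β n I + dsum good Y β n I := fun X Y n => by
    simp only [dsum, List.filter_append, ptVal_append]
  induction L with
  | nil => simp [pairPts, dsum, ptVal]
  | cons x L ih =>
    -- the head: one left tree against all right trees
    have hge : ∀ X : List (Shape × FreeAlgebra R σ),
        ptVal (X.map fun f => (Shape.node x.1 f.1, x.2 * f.2)) = x.2 * ptVal X := fun X => by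
      simp only [ptVal, List.map_map, Function.comp_def]
      exact List.sum_map_mul_left X Prod.snd x.2
    have hx : dsum good (M.map fun f => (Shape.node x.1 f.1, x.2 * f.2)) β k I =
        ∑ n ∈ Finset.range (k + 1),
          ((if x.1.size = n ∧ des good x.1 β = some I then x.2 else 0) *
              ptVal (M.filter fun f => f.1.size = k - n) +
            (if x.1.size = n ∧ des good x.1 β = none then x.2 else 0) *
              dsum good M (β + n) (k - n) I) := by
      by_cases hxk : x.1.size ≤ k
      · symm
        refine (Finset.sum_eq_single_of_mem (s := Finset.range (k + 1)) x.1.size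
          (Finset.mem_range.2 (by omega)) fun n _ hn => ?_).trans ?_
        · have h1 : ¬(x.1.size = n ∧ des good x.1 β = some I) := fun h => hn h.1.symm
          have h2 : ¬(x.1.size = n ∧ des good x.1 β = none) := fun h => hn h.1.symm
          rw [if_neg h1, if_neg h2, zero_mul, zero_mul, add_zero]
        unfold dsum
        rw [List.filter_map, hge]
        cases hde : des good x.1 β with
        | none =>
          have c1 : ¬(x.1.size = x.1.size ∧ none = some I) := fun h => Option.some_ne_none I h.2.symm
          rw [if_neg c1, if_pos (And.intro rfl rfl), zero_mul, zero_add]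
          congr 2
          refine List.filter_congr fun f _ => ?_
          simp only [Function.comp_apply, decide_eq_decide, Shape.size, des, hde, Option.none_or]
          constructor
          · rintro ⟨hs, hd⟩
            have hs' : x.1.size + f.1.size = k := by omega
            rw [hs', if_neg hgk]
            exact ⟨rfl, hd⟩
          · rintro ⟨hs, hd⟩
            rw [hs, if_neg hgk] at hd
            exact ⟨by omega, hd⟩
        | some J =>
          have c2 : ¬(x.1.size = x.1.size ∧ some J = none) := fun h => Option.some_ne_none J h.2
          by_cases hJ : J = I
          · rw [if_pos (And.intro rfl (congrArg some hJ)), if_neg c2, zero_mul, add_zero]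
            congr 2
            refine List.filter_congr fun f _ => ?_
            simp only [Function.comp_apply, decide_eq_decide, Shape.size, des, hde, Option.some_or]
            constructor
            · intro hs
              have hs' : x.1.size + f.1.size = k := by omega
              rw [hs', if_neg hgk, hJ]
              exact ⟨rfl, rfl⟩
            · rintro ⟨hs, -⟩; omega
          · have c1 : ¬(x.1.size = x.1.size ∧ some J = some I) := fun h => hJ (Option.some.inj h.2)
            rw [if_neg c1, if_neg c2, zero_mul, zero_mul, add_zero,
              List.filter_eq_nil_iff.2 fun f _ hf => ?_]
            · simp [ptVal]
            · simp only [Function.comp_apply, Shape.size, des, hde, Option.some_or,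
                decide_eq_true_eq] at hf
              obtain ⟨hs, hd⟩ := hf
              rw [hs, if_neg hgk, Option.some.injEq] at hd
              exact hJ hd
      · have h0 : dsum good (M.map fun f => (Shape.node x.1 f.1, x.2 * f.2)) β k I = 0 := by
          unfold dsum
          rw [List.filter_eq_nil_iff.2 fun y hy hpy => ?_]
          · simp [ptVal]
          · rw [List.mem_map] at hy
            obtain ⟨f, -, rfl⟩ := hy
            simp only [decide_eq_true_eq, Shape.size] at hpy
            exact absurd hpy.1 (by omega)
        rw [h0]
        symm
        refine Finset.sum_eq_zero fun n hn => ?_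
        have hne : ¬x.1.size = n := by rw [Finset.mem_range] at hn; omega
        have h1 : ¬(x.1.size = n ∧ des good x.1 β = some I) := fun h => hne h.1
        have h2 : ¬(x.1.size = n ∧ des good x.1 β = none) := fun h => hne h.1
        rw [if_neg h1, if_neg h2, zero_mul, zero_mul, add_zero]
    rw [pairPts, happ, ih, hx, ← Finset.sum_add_distrib]
    refine Finset.sum_congr rfl fun n _ => ?_
    have hcD : dsum good (x :: L) β n I =
        (if x.1.size = n ∧ des good x.1 β = some I then x.2 else 0) + dsum good L β n I :=
      hcons _ x L
    have hcU : ptVal ((x :: L).filter fun e => e.1.size = n ∧ des good e.1 β = none) =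
        (if x.1.size = n ∧ des good x.1 β = none then x.2 else 0) +
          ptVal (L.filter fun e => e.1.size = n ∧ des good e.1 β = none) := hcons _ x L
    rw [hcD, hcU]
    simp only [add_mul]
    abel

end Model

end Summit.ValiantsHypothesis.ValiantsHypothesis.Theorems.NcHankelIntervalModel
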